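import Literature.NumberTheory.LFunctions.Zhang2022.KnifeEdgeLenZDegreeShortDensePiece

/-!
# Zhang (2022), rung F-S3 (Landau–Siegel programme, §D CHAIN #1 toeplitz closure squad): the three poly-class darkness
# inputs of the ports REDUCED to BINOMIAL short pairs — sesquilinearity of the dark slots and the Taylor basis at the kink
# (PROVED; nothing asserted)

Y. Zhang, *Discrete mean estimates and the Landau–Siegel zero*, arXiv:2211.02515v1 [Zhang2022LandauSiegel] — an
unrefereed manuscript under adjudication. **WHAT THIS IS NOT: not a claim about Theorems 1–2 of arXiv:2211.02515, about
Landau–Siegel zeros, or about Parity. The programme SEARCHES and TYPES; no claim about Landau–Siegel zeros, Theorems 1–2 of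
arXiv:2211.02515 or a repaired Margin232 until a kernel theorem says so.** Every `def` below has a body (cell values,
binomial pieces, a pair class); every `theorem` is finite-sum algebra or an implication between the tree's statement
SHAPES (`KnifeEdge.CrossTablePsiOn`, `DualCrossTablePsiOn`, `InClassMeanPiece` — asserted by no one). No new open `Prop`.

## What this file does (ls-knife-toeplitz-typer-1 g2, cell `landau-siegel` §D, 2026-08-27)

After the darkness PORTS (`KnifeEdgeLenZDegreeShortPolyDense` p536434, `KnifeEdgeLenZDegreeShortDensePiece` p538281, and
the Summits-side `Theorems/ZDegreeToeplitzBandShortPairs{TauTwoDark,CrossDegOne,DualDegOne}OfPolyPiece`), the route items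
stmt-Parity-20429/20444/20445 and the kill path of stmt-Parity-20430 rest on the repaired K0 (stmt-Parity-20459) and on
THREE OPEN INPUTS of one shape: darkness of a ψ-graded cell on the class `KnifeEdge.PolyShortPairs` of POLYNOMIAL short
pairs, `∃ c₀, ∀ c′ ≥ c₀, InClassMeanPiece c′ → [Dual]CrossTablePsiOn c′ PolyShortPairs d 0` (`d = 2, 1, 1`). Those inputs
quantify over ALL complex polynomials `p` with `p(θ) = 0` on each side. This leaf shrinks them, in the kernel, to ONE
explicit two-parameter family per side:

* Part 1 — the cells are SESQUILINEAR: the profile polynomial `profPoly` is linear in the profile, the graded mean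
  `zDegMeanPsi` is linear in its first value table and conjugate-linear in its second; hence the degree-`d` cross cell of
  `(Σ_j b_j g_j, Σ_i a_i f_i)` is `Σ_j Σ_i conj b_j · conj a_i · cell(g_j, f_i)` (`crossCell_sum_sum`) and the dual cell of
  `(Σ_i a_i g₁ᵢ, Σ_j b_j g₂ⱼ)` is `Σ_i Σ_j a_i · conj b_j · cell(g₁ᵢ, g₂ⱼ)` (`dualCell_sum_sum`).
* Part 2 — DARKNESS TRANSFERS along finite combinations: if every cell `(g_j, f_i)` of two finite families is `o(𝔞𝔓)`
  under (A) eventually, so is the cell of any pair of linear combinations (`crossCell_dark_of_sum`, `dualCell_dark_of_sum`;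
  `ε/(Σ|b_j||a_i| + 1)` and `forAllLarge_fintype`).
* Part 3 — BINOMIAL short pieces `binomPiece θ k = (x − θ)^k·1_{x<θ}` (`k ≥ 1`, `θ ≤ 1`; on the `n`-scale the weight
  `((log n − θ log P)/log P)^k·1_{n<P^θ}`, the `k`-th power of the printed Lemma 8.2 / 8.4 weight `log(x/n)`, `x = P^θ`,
  up to the sign `(−1)^k` and the normalisation `log^k P`) are polynomial short pieces, and the TAYLOR decomposition at the
  kink: every polynomial short piece of length `θ` is a finite ℂ-combination of `binomPiece θ (k+1)`, with its marked
  derivative decomposing alike (`PolyShortPiece.exists_binom_decomp`; Mathlib's `Polynomial.sum_taylor_eq` and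
  `taylor_coeff_zero = p(θ) = 0`).
* Part 4 — the class `BinomShortPairs` (pairs of binomial pieces, `0 < θ_f, θ_g ≤ 1`, `θ_f + θ_g < 1`, orders `≥ 1`) is a
  sub-class of `PolyShortPairs`, and the REDUCTIONS: `crossTablePsiOn_poly_zero_of_binom : CrossTablePsiOn c′ BinomShortPairs d 0
  → CrossTablePsiOn c′ PolyShortPairs d 0`, its dual twin, the rider/eventually forms whose conclusions are the ports'
  darkness binders token for token, and the composed ports (binomial darkness + repaired K0 ⇒ darkness on ALL short pairs,
  `TauTwoDarkShort` eventually). Pieces of non-positive length have the zero profile polynomial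
  (`profPoly_eq_zero_of_vanish`), which is why `BinomShortPairs` may demand `0 < θ`.

So each of the three open inputs is now: for every admissible `(θ_f, k; θ_g, l)`, the cell of the two binomial weights is
`o(𝔞𝔓)` under (A), eventually — a statement about one explicit family of χψ-twisted Dirichlet polynomials with
power-of-`log(x/n)` weights. Nothing number-theoretic is proved here.

WHY THE FINITE-COMBINATION STEP IS LEGITIMATE WITHOUT COEFFICIENT BOUNDS (statement guard, ls-theory g5 (b1) / ls-knife-crit-1
g9, 2026-08-27): the restricted slots `KnifeEdge.CrossTablePsiOn c′ 𝒞 d X` / `DualCrossTablePsiOn` (`KnifeEdgeLenZDegreeShort`)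
are POINTWISE IN THE PAIR — the eventual quantifier `ForAllLarge` sits INSIDE `∀ (f f′ g g′), … → 𝒞 f f′ g g′ → ∀ ε > 0, …`,
so the modulus threshold may depend on the pair and on `ε`. Darkness (`X ≡ 0`) of finitely many cells therefore combines by
one finite intersection of thresholds (`forAllLarge_fintype`) after shrinking `ε` to `ε/(Σ_jΣ_i |b_j||a_i| + 1)`; no bound
uniform over the class, and no linearity of a functional `X`, is needed or claimed (the sesquilinearity lemmas of Part 1 are
stated for arbitrary value tables and arbitrary `Finset`-indexed families, the darkness transfer of Part 2 for an arbitrary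
pair of finite families — reusable for multi-kink piecewise-polynomial classes — and the class reduction of Part 4 only at
`X = 0` / `Y = 0`). In the cell's books the three inputs are thereby RENAMED («on `BinomShortPairs`, per `(θ_f,k;θ_g,l)`»),
not discharged.

Typer: ls-knife-toeplitz-typer-1 g2 (literature-prover), file-disjoint from `KnifeEdgeLenZDegreeK0Short` /
`Section8Dipole*` (ls-knife-K0-p1) and `Theorems/ZDegreeToeplitzBandDarkSchur` (ls-knife-typer-3).

## References
* Y. Zhang, arXiv:2211.02515v1 (2022), §7 (7.2) p. 13; §8 (8.5), Lemma 8.1, Lemma 8.2 p. 16, Lemma 8.4 p. 17; §2 (2.16)–(2.17).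
  [cite: Zhang2022LandauSiegel, §7 (7.2) p.13; §8 (8.5) Lemma 8.2 p.16, Lemma 8.4 p.17]
-/

noncomputable section

open Complex Real ComplexConjugate Finset Polynomial

namespace Literature.NumberTheory.LFunctions.Zhang2022.KnifeEdge

open Repair Skeleton

/-! ### Part 1 — linearity of the profile polynomial and sesquilinearity of the graded mean; the two cells -/

section Linear

variable {D : ℕ} (χ : DirichletCharacter ℂ D) (x : Chr D) (N : ℕ) (s : ℂ)

/-- **The profile polynomial is linear in the profile:** `Σ_n χψ(n)·(Σ_i a_i u_i)(z_n)·n^{−s} = Σ_i a_i·Σ_n χψ(n)u_i(z_n)n^{−s}`.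
[cite: Zhang2022LandauSiegel, §2 (2.23), §7 (7.2) p.13] -/
theorem profPoly_finset_sum {ι : Type*} (t : Finset ι) (a : ι → ℂ) (u : ι → ℝ → ℂ) :
    profPoly χ x (∑ i ∈ t, a i • u i) N s = ∑ i ∈ t, a i * profPoly χ x (u i) N s := by
  unfold profPoly
  have happ : ∀ z : ℝ, (∑ i ∈ t, a i • u i) z = ∑ i ∈ t, a i * u i z := fun z => by
    simp [Finset.sum_apply]
  simp_rw [happ, Finset.mul_sum, Finset.sum_mul]
  rw [Finset.sum_comm]
  refine Finset.sum_congr rfl fun i _ => ?_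
  refine Finset.sum_congr rfl fun n _ => ?_
  ring

/-- A profile vanishing on `[0, ∞)` has the ZERO profile polynomial (every sample point `z_n = log n/log P` is `≥ 0`).
[cite: Zhang2022LandauSiegel, §2 (2.23), §7 (7.2) p.13] -/
theorem profPoly_eq_zero_of_vanish {u : ℝ → ℂ} (hu : ∀ z : ℝ, 0 ≤ z → u z = 0) : profPoly χ x u N s = 0 := by
  unfold profPoly
  refine Finset.sum_eq_zero fun n _ => ?_
  have hz : 0 ≤ Real.log n / Real.log (bigP D) := by
    apply div_nonneg (Real.log_natCast_nonneg n)
    rw [bigP, Real.log_exp]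
    exact pow_nonneg (Real.log_natCast_nonneg D) 9
  rw [hu _ hz, mul_zero, zero_mul]

variable (c' : ℝ) (d : ℤ)

/-- The graded mean is additive (finite sums) in its FIRST value table. [cite: Zhang2022LandauSiegel, §2 (2.16)–(2.17)] -/
theorem zDegMeanPsi_finset_sum_left {ι : Type*} (t : Finset ι) (F : ι → Chr D → ℂ → ℂ) (G : Chr D → ℂ → ℂ) :
    zDegMeanPsi c' χ d (fun y w => ∑ i ∈ t, F i y w) G = ∑ i ∈ t, zDegMeanPsi c' χ d (F i) G := by
  unfold zDegMeanPsi
  simp_rw [Finset.sum_mul, Finset.mul_sum, Finset.sum_mul]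
  rw [Finset.sum_comm]

/-- The graded mean is additive (finite sums) in its SECOND value table. [cite: Zhang2022LandauSiegel, §2 (2.16)–(2.17)] -/
theorem zDegMeanPsi_finset_sum_right {ι : Type*} (t : Finset ι) (F : Chr D → ℂ → ℂ) (G : ι → Chr D → ℂ → ℂ) :
    zDegMeanPsi c' χ d F (fun y w => ∑ i ∈ t, G i y w) = ∑ i ∈ t, zDegMeanPsi c' χ d F (G i) := by
  unfold zDegMeanPsi
  simp_rw [map_sum, Finset.mul_sum, Finset.sum_mul]
  rw [Finset.sum_comm]

/-- The graded mean is homogeneous in its FIRST value table. [cite: Zhang2022LandauSiegel, §2 (2.16)–(2.17)] -/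
theorem zDegMeanPsi_const_mul_left (a : ℂ) (F G : Chr D → ℂ → ℂ) :
    zDegMeanPsi c' χ d (fun y w => a * F y w) G = a * zDegMeanPsi c' χ d F G := by
  unfold zDegMeanPsi
  rw [Finset.mul_sum]
  refine Finset.sum_congr rfl fun i _ => ?_
  ring

/-- The graded mean is CONJUGATE-homogeneous in its SECOND value table. [cite: Zhang2022LandauSiegel, §2 (2.16)–(2.17)] -/
theorem zDegMeanPsi_const_mul_right (a : ℂ) (F G : Chr D → ℂ → ℂ) :
    zDegMeanPsi c' χ d F (fun y w => a * G y w) = conj a * zDegMeanPsi c' χ d F G := by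
  unfold zDegMeanPsi
  rw [Finset.mul_sum]
  refine Finset.sum_congr rfl fun i _ => ?_
  rw [map_mul]
  ring

/-- The graded mean of a ZERO second table vanishes. [cite: Zhang2022LandauSiegel, §2 (2.16)–(2.17)] -/
theorem zDegMeanPsi_zero_right (F : Chr D → ℂ → ℂ) : zDegMeanPsi c' χ d F (fun _ _ => 0) = 0 := by
  simp [zDegMeanPsi]

/-- The graded mean of a ZERO first table vanishes. [cite: Zhang2022LandauSiegel, §2 (2.16)–(2.17)] -/
theorem zDegMeanPsi_zero_left (G : Chr D → ℂ → ℂ) : zDegMeanPsi c' χ d (fun _ _ => 0) G = 0 := by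
  simp [zDegMeanPsi]

end Linear

section Cells

variable (c' : ℝ) {D : ℕ} (χ : DirichletCharacter ℂ D) (d : ℕ)

/-- **The degree-`d` ψ-graded CROSS CELL of the pair `(g, f)` at modulus `D`:** `τ_d^ψ(conj Q_g, H_f)
= Σ_{(ψ,ρ)} Re 𝔠*·Z(ρ,ψ)^d·conj Q_g(ρ)·conj H_f(ρ)·Re ω`, both profile polynomials of length `⌊P⌋+1` — the quantity the
restricted slot `CrossTablePsiOn c′ 𝒞 d X` estimates (`crossTablePsiOn_zero_iff`). [cite: Zhang2022LandauSiegel, §8 (8.5), Lemma 8.1 p.16] -/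
def crossCell (g f : ℝ → ℂ) : ℂ :=
  zDegMeanPsi c' χ d (fun x t => conj (profPoly χ x g (⌊bigP D⌋₊ + 1) t))
    (fun x t => profPoly χ x f (⌊bigP D⌋₊ + 1) t)

/-- **The degree-`d` ψ-graded DUAL CELL of the pair `(g₁, g₂)` at modulus `D`:**
`Σ_{(ψ,ρ)} Re 𝔠*·Z(ρ,ψ)^d·conj Q_{g₂}(ρ)·Q_{g₁}(ρ)·Re ω` — the quantity `DualCrossTablePsiOn c′ 𝒞 d Y` estimates
(`dualCrossTablePsiOn_zero_iff`). [cite: Zhang2022LandauSiegel, §2 (2.17), §8 (8.5) p.16] -/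
def dualCell (g₁ g₂ : ℝ → ℂ) : ℂ :=
  zDegMeanPsi c' χ d (fun x t => conj (profPoly χ x g₂ (⌊bigP D⌋₊ + 1) t))
    (fun x t => conj (profPoly χ x g₁ (⌊bigP D⌋₊ + 1) t))

variable {c' d}

/-- Unfolding: darkness of the degree-`d` cross slot on `𝒞` is the estimate `‖crossCell‖ ≤ ε𝔞𝔓` for every `𝒞`-pair,
every `ε > 0`, under (A), eventually. [cite: Zhang2022LandauSiegel, §8 (8.5) p.16] -/
theorem crossTablePsiOn_zero_iff {𝒞 : PairClass} : CrossTablePsiOn c' 𝒞 d (fun _ _ _ _ => 0) ↔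
    ∀ (f f' g g' : ℝ → ℂ), InClassPiece f f' → InClassPiece g g' → 𝒞 f f' g g' → ∀ ε : ℝ, 0 < ε →
      ForAllLarge fun D _ χ => AssumptionA D χ → ‖crossCell c' χ d g f‖ ≤ ε * frakA χ * frakP D := by
  unfold CrossTablePsiOn crossCell
  simp only [zero_mul, sub_zero]

/-- Unfolding: darkness of the degree-`d` dual slot on `𝒞` is the estimate `‖dualCell‖ ≤ ε𝔞𝔓` for every `𝒞`-pair,
every `ε > 0`, under (A), eventually. [cite: Zhang2022LandauSiegel, §2 (2.17), §8 (8.5) p.16] -/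
theorem dualCrossTablePsiOn_zero_iff {𝒞 : PairClass} : DualCrossTablePsiOn c' 𝒞 d (fun _ _ _ _ => 0) ↔
    ∀ (g₁ g₁' g₂ g₂' : ℝ → ℂ), InClassPiece g₁ g₁' → InClassPiece g₂ g₂' → 𝒞 g₁ g₁' g₂ g₂' → ∀ ε : ℝ, 0 < ε →
      ForAllLarge fun D _ χ => AssumptionA D χ → ‖dualCell c' χ d g₁ g₂‖ ≤ ε * frakA χ * frakP D := by
  unfold DualCrossTablePsiOn dualCell
  simp only [zero_mul, sub_zero]

/-- **SESQUILINEARITY OF THE CROSS CELL:** the cell of `(Σ_j b_j g_j, Σ_i a_i f_i)` is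
`Σ_j Σ_i conj b_j · conj a_i · cell(g_j, f_i)` (conjugate-linear in both pieces). [cite: Zhang2022LandauSiegel, §2 (2.16)–(2.17), §8 (8.5) p.16] -/
theorem crossCell_sum_sum {ι κ : Type*} (si : Finset ι) (sj : Finset κ) (a : ι → ℂ) (b : κ → ℂ)
    (F : ι → ℝ → ℂ) (G : κ → ℝ → ℂ) :
    crossCell c' χ d (∑ j ∈ sj, b j • G j) (∑ i ∈ si, a i • F i) =
      ∑ j ∈ sj, ∑ i ∈ si, conj (b j) * conj (a i) * crossCell c' χ d (G j) (F i) := by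
  unfold crossCell
  have hG : (fun (y : Chr D) (t : ℂ) => conj (profPoly χ y (∑ j ∈ sj, b j • G j) (⌊bigP D⌋₊ + 1) t)) =
      fun y t => ∑ j ∈ sj, conj (b j) * conj (profPoly χ y (G j) (⌊bigP D⌋₊ + 1) t) := by
    funext y t
    rw [profPoly_finset_sum, map_sum]
    exact Finset.sum_congr rfl fun j _ => map_mul _ _ _
  have hF : (fun (y : Chr D) (t : ℂ) => profPoly χ y (∑ i ∈ si, a i • F i) (⌊bigP D⌋₊ + 1) t) =
      fun y t => ∑ i ∈ si, a i * profPoly χ y (F i) (⌊bigP D⌋₊ + 1) t := by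
    funext y t
    rw [profPoly_finset_sum]
  rw [hG, hF, zDegMeanPsi_finset_sum_left]
  refine Finset.sum_congr rfl fun j _ => ?_
  rw [zDegMeanPsi_const_mul_left, zDegMeanPsi_finset_sum_right, Finset.mul_sum]
  refine Finset.sum_congr rfl fun i _ => ?_
  rw [zDegMeanPsi_const_mul_right, mul_assoc]

/-- **SESQUILINEARITY OF THE DUAL CELL:** the cell of `(Σ_i a_i g₁ᵢ, Σ_j b_j g₂ⱼ)` is
`Σ_i Σ_j a_i · conj b_j · cell(g₁ᵢ, g₂ⱼ)` (linear in the first piece, conjugate-linear in the second).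
[cite: Zhang2022LandauSiegel, §2 (2.17), §8 (8.5) p.16] -/
theorem dualCell_sum_sum {ι κ : Type*} (si : Finset ι) (sj : Finset κ) (a : ι → ℂ) (b : κ → ℂ)
    (G₁ : ι → ℝ → ℂ) (G₂ : κ → ℝ → ℂ) :
    dualCell c' χ d (∑ i ∈ si, a i • G₁ i) (∑ j ∈ sj, b j • G₂ j) =
      ∑ i ∈ si, ∑ j ∈ sj, a i * conj (b j) * dualCell c' χ d (G₁ i) (G₂ j) := by
  unfold dualCell
  have h2 : (fun (y : Chr D) (t : ℂ) => conj (profPoly χ y (∑ j ∈ sj, b j • G₂ j) (⌊bigP D⌋₊ + 1) t)) =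
      fun y t => ∑ j ∈ sj, conj (b j) * conj (profPoly χ y (G₂ j) (⌊bigP D⌋₊ + 1) t) := by
    funext y t
    rw [profPoly_finset_sum, map_sum]
    exact Finset.sum_congr rfl fun j _ => map_mul _ _ _
  have h1 : (fun (y : Chr D) (t : ℂ) => conj (profPoly χ y (∑ i ∈ si, a i • G₁ i) (⌊bigP D⌋₊ + 1) t)) =
      fun y t => ∑ i ∈ si, conj (a i) * conj (profPoly χ y (G₁ i) (⌊bigP D⌋₊ + 1) t) := by
    funext y t
    rw [profPoly_finset_sum, map_sum]
    exact Finset.sum_congr rfl fun i _ => map_mul _ _ _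
  rw [h2, h1, zDegMeanPsi_finset_sum_right]
  refine Finset.sum_congr rfl fun i _ => ?_
  rw [zDegMeanPsi_const_mul_right, Complex.conj_conj, zDegMeanPsi_finset_sum_left, Finset.mul_sum]
  refine Finset.sum_congr rfl fun j _ => ?_
  rw [zDegMeanPsi_const_mul_left, mul_assoc]

end Cells

/-! ### Part 2 — darkness transfers along finite linear combinations -/

section Transfer

variable {c' : ℝ} {d : ℕ}

/-- **DARKNESS OF THE CROSS CELL TRANSFERS TO FINITE COMBINATIONS:** if for two finite families `(f_i)_{i ∈ s_i}`,
`(g_j)_{j ∈ s_j}` every cross cell `(g_j, f_i)` is `o(𝔞𝔓)` under (A), eventually, then so is the cross cell of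
`(Σ_j b_j g_j, Σ_i a_i f_i)` for all coefficients — `ε ↦ ε/(Σ_jΣ_i |b_j||a_i| + 1)`, one threshold for the finitely many
cells (`forAllLarge_fintype` — legitimate because each cell's threshold is its own: the slot is pointwise in the pair),
sesquilinearity and the triangle inequality. The families, the index sets and the coefficients are arbitrary (no class is
mentioned): this is the transfer lemma for any finitely generated sub-cone of pieces. [cite: Zhang2022LandauSiegel, §2 (2.16)–(2.17), §8 (8.5) p.16] -/
theorem crossCell_dark_of_sum {ι κ : Type*} (si : Finset ι) (sj : Finset κ) (a : ι → ℂ) (b : κ → ℂ)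
    (F : ι → ℝ → ℂ) (G : κ → ℝ → ℂ)
    (h : ∀ i ∈ si, ∀ j ∈ sj, ∀ ε : ℝ, 0 < ε → ForAllLarge fun D _ χ => AssumptionA D χ →
      ‖crossCell c' χ d (G j) (F i)‖ ≤ ε * frakA χ * frakP D) :
    ∀ ε : ℝ, 0 < ε → ForAllLarge fun D _ χ => AssumptionA D χ →
      ‖crossCell c' χ d (∑ j ∈ sj, b j • G j) (∑ i ∈ si, a i • F i)‖ ≤ ε * frakA χ * frakP D := by
  intro ε hε
  set M : ℝ := ∑ j ∈ sj, ∑ i ∈ si, ‖b j‖ * ‖a i‖ with hM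
  have hM0 : 0 ≤ M :=
    Finset.sum_nonneg fun j _ => Finset.sum_nonneg fun i _ => mul_nonneg (norm_nonneg _) (norm_nonneg _)
  have hM1 : 0 < M + 1 := by linarith
  have hε' : 0 < ε / (M + 1) := div_pos hε hM1
  have hall := forAllLarge_fintype (ι := (si ×ˢ sj : Finset (ι × κ)))
    (S := fun p D _ χ => AssumptionA D χ →
      ‖crossCell c' χ d (G p.1.2) (F p.1.1)‖ ≤ ε / (M + 1) * frakA χ * frakP D)
    fun p => h p.1.1 (Finset.mem_product.mp p.2).1 p.1.2 (Finset.mem_product.mp p.2).2 _ hε'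
  refine hall.mono fun D _ χ _ _ hD hA => ?_
  have hAP : 0 ≤ frakA χ * frakP D := mul_nonneg (frakA_nonneg χ) (frakP_nonneg D)
  have hfin : M * (ε / (M + 1)) ≤ ε := by
    rw [mul_div_assoc', div_le_iff₀ hM1]
    nlinarith
  rw [crossCell_sum_sum]
  calc ‖∑ j ∈ sj, ∑ i ∈ si, conj (b j) * conj (a i) * crossCell c' χ d (G j) (F i)‖
      ≤ ∑ j ∈ sj, ‖∑ i ∈ si, conj (b j) * conj (a i) * crossCell c' χ d (G j) (F i)‖ := norm_sum_le _ _
    _ ≤ ∑ j ∈ sj, ∑ i ∈ si, ‖b j‖ * ‖a i‖ * (ε / (M + 1) * frakA χ * frakP D) := by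
        refine Finset.sum_le_sum fun j hj => (norm_sum_le _ _).trans (Finset.sum_le_sum fun i hi => ?_)
        rw [norm_mul, norm_mul, Complex.norm_conj, Complex.norm_conj]
        exact mul_le_mul_of_nonneg_left (hD ⟨(i, j), Finset.mem_product.mpr ⟨hi, hj⟩⟩ hA)
          (mul_nonneg (norm_nonneg _) (norm_nonneg _))
    _ = M * (ε / (M + 1)) * (frakA χ * frakP D) := by
        simp_rw [← Finset.sum_mul]
        rw [← hM]
        ring
    _ ≤ ε * (frakA χ * frakP D) := mul_le_mul_of_nonneg_right hfin hAP
    _ = ε * frakA χ * frakP D := (mul_assoc _ _ _).symm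

/-- **DARKNESS OF THE DUAL CELL TRANSFERS TO FINITE COMBINATIONS** (the twin of `crossCell_dark_of_sum`).
[cite: Zhang2022LandauSiegel, §2 (2.17), §8 (8.5) p.16] -/
theorem dualCell_dark_of_sum {ι κ : Type*} (si : Finset ι) (sj : Finset κ) (a : ι → ℂ) (b : κ → ℂ)
    (G₁ : ι → ℝ → ℂ) (G₂ : κ → ℝ → ℂ)
    (h : ∀ i ∈ si, ∀ j ∈ sj, ∀ ε : ℝ, 0 < ε → ForAllLarge fun D _ χ => AssumptionA D χ →
      ‖dualCell c' χ d (G₁ i) (G₂ j)‖ ≤ ε * frakA χ * frakP D) :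
    ∀ ε : ℝ, 0 < ε → ForAllLarge fun D _ χ => AssumptionA D χ →
      ‖dualCell c' χ d (∑ i ∈ si, a i • G₁ i) (∑ j ∈ sj, b j • G₂ j)‖ ≤ ε * frakA χ * frakP D := by
  intro ε hε
  set M : ℝ := ∑ i ∈ si, ∑ j ∈ sj, ‖a i‖ * ‖b j‖ with hM
  have hM0 : 0 ≤ M :=
    Finset.sum_nonneg fun i _ => Finset.sum_nonneg fun j _ => mul_nonneg (norm_nonneg _) (norm_nonneg _)
  have hM1 : 0 < M + 1 := by linarith
  have hε' : 0 < ε / (M + 1) := div_pos hε hM1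
  have hall := forAllLarge_fintype (ι := (si ×ˢ sj : Finset (ι × κ)))
    (S := fun p D _ χ => AssumptionA D χ →
      ‖dualCell c' χ d (G₁ p.1.1) (G₂ p.1.2)‖ ≤ ε / (M + 1) * frakA χ * frakP D)
    fun p => h p.1.1 (Finset.mem_product.mp p.2).1 p.1.2 (Finset.mem_product.mp p.2).2 _ hε'
  refine hall.mono fun D _ χ _ _ hD hA => ?_
  have hAP : 0 ≤ frakA χ * frakP D := mul_nonneg (frakA_nonneg χ) (frakP_nonneg D)
  have hfin : M * (ε / (M + 1)) ≤ ε := by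
    rw [mul_div_assoc', div_le_iff₀ hM1]
    nlinarith
  rw [dualCell_sum_sum]
  calc ‖∑ i ∈ si, ∑ j ∈ sj, a i * conj (b j) * dualCell c' χ d (G₁ i) (G₂ j)‖
      ≤ ∑ i ∈ si, ‖∑ j ∈ sj, a i * conj (b j) * dualCell c' χ d (G₁ i) (G₂ j)‖ := norm_sum_le _ _
    _ ≤ ∑ i ∈ si, ∑ j ∈ sj, ‖a i‖ * ‖b j‖ * (ε / (M + 1) * frakA χ * frakP D) := by
        refine Finset.sum_le_sum fun i hi => (norm_sum_le _ _).trans (Finset.sum_le_sum fun j hj => ?_)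
        rw [norm_mul, norm_mul, Complex.norm_conj]
        exact mul_le_mul_of_nonneg_left (hD ⟨(i, j), Finset.mem_product.mpr ⟨hi, hj⟩⟩ hA)
          (mul_nonneg (norm_nonneg _) (norm_nonneg _))
    _ = M * (ε / (M + 1)) * (frakA χ * frakP D) := by
        simp_rw [← Finset.sum_mul]
        rw [← hM]
        ring
    _ ≤ ε * (frakA χ * frakP D) := mul_le_mul_of_nonneg_right hfin hAP
    _ = ε * frakA χ * frakP D := (mul_assoc _ _ _).symm

end Transfer

/-! ### Part 3 — binomial short pieces and the Taylor decomposition of a polynomial short piece at its kink -/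

section Binom

variable {θ : ℝ} {k : ℕ}

/-- The binomial polynomial `(X − θ)^k`. [cite: Zhang2022LandauSiegel, §8 Lemma 8.2 p.16] -/
def binomPoly (θ : ℝ) (k : ℕ) : ℂ[X] := (X - C (θ : ℂ)) ^ k

/-- **The BINOMIAL short piece of length `θ` and order `k`:** `x ↦ (x − θ)^k` for `x < θ`, `0` for `x ≥ θ` — on the
`n`-scale (`x = log n/log P`) the weight `(−1)^k (log(P^θ/n))^k / log^k P · 1_{n < P^θ}`, the `k`-th power of the printed
weight `log(x/n)` of Lemma 8.2 / Lemma 8.4 (there with `x = P^θ`). [cite: Zhang2022LandauSiegel, §8 Lemma 8.2 p.16, Lemma 8.4 p.17, §7 (7.2) p.13] -/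
def binomPiece (θ : ℝ) (k : ℕ) : ℝ → ℂ := polyPiece θ (binomPoly θ k)

/-- Its marked derivative `k(x − θ)^{k−1}·1_{x<θ}` (as `polyPieceDeriv`). [cite: Zhang2022LandauSiegel, §8 Lemma 8.2 p.16, §7 (7.2) p.13] -/
def binomPieceDeriv (θ : ℝ) (k : ℕ) : ℝ → ℂ := polyPieceDeriv θ (binomPoly θ k)

/-- `(X − θ)^k` vanishes at `θ` for `k ≠ 0` (continuity across the kink). [cite: Zhang2022LandauSiegel, §7 (7.2) p.13] -/
theorem binomPoly_eval_self (hk : k ≠ 0) : (binomPoly θ k).eval (θ : ℂ) = 0 := by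
  simp [binomPoly, hk]

/-- Unfolding below the kink: `binomPiece θ k x = (x − θ)^k`. [cite: Zhang2022LandauSiegel, §8 Lemma 8.2 p.16] -/
theorem binomPiece_of_lt {x : ℝ} (hx : x < θ) : binomPiece θ k x = ((x : ℂ) - θ) ^ k := by
  simp [binomPiece, polyPiece_of_lt hx, binomPoly]

/-- Unfolding above the kink: `binomPiece θ k x = 0`. [cite: Zhang2022LandauSiegel, §8 Lemma 8.2 p.16] -/
theorem binomPiece_of_le {x : ℝ} (hx : θ ≤ x) : binomPiece θ k x = 0 := polyPiece_of_le hx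

/-- **A binomial piece of length `θ ≤ 1` and order `k ≥ 1` is a polynomial short piece** (hence a short in-class piece:
`PolyShortPiece.shortPiece`, `.inClassPiece`). [cite: Zhang2022LandauSiegel, §7 (7.2) p.13, §8 Lemma 8.2 p.16] -/
theorem polyShortPiece_binom (hθ : θ ≤ 1) (hk : 1 ≤ k) : PolyShortPiece θ (binomPiece θ k) (binomPieceDeriv θ k) :=
  ⟨hθ, binomPoly θ k, binomPoly_eval_self (by omega), rfl, rfl⟩

/-- `polyPiece θ` is linear in the polynomial: a combination `Σ_i C(c_i)·q_i` gives the combination of the pieces.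
[cite: Zhang2022LandauSiegel, §7 (7.2) p.13] -/
theorem polyPiece_finset_sum {ι : Type*} (t : Finset ι) (c : ι → ℂ) (q : ι → ℂ[X]) :
    polyPiece θ (∑ i ∈ t, C (c i) * q i) = ∑ i ∈ t, c i • polyPiece θ (q i) := by
  funext x
  rw [Finset.sum_apply]
  by_cases hx : x < θ
  · simp only [polyPiece_of_lt hx, Pi.smul_apply, smul_eq_mul, eval_finsetSum, eval_mul, eval_C]
  · simp only [polyPiece_of_le (not_lt.mp hx), Pi.smul_apply, smul_eq_mul, mul_zero, Finset.sum_const_zero]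

/-- `polyPieceDeriv θ` is linear in the polynomial. [cite: Zhang2022LandauSiegel, §7 (7.2) p.13] -/
theorem polyPieceDeriv_finset_sum {ι : Type*} (t : Finset ι) (c : ι → ℂ) (q : ι → ℂ[X]) :
    polyPieceDeriv θ (∑ i ∈ t, C (c i) * q i) = ∑ i ∈ t, c i • polyPieceDeriv θ (q i) := by
  funext x
  rw [Finset.sum_apply]
  by_cases hx : x < θ
  · simp only [polyPieceDeriv_of_lt hx, Pi.smul_apply, smul_eq_mul, map_sum, derivative_C_mul, eval_finsetSum,
      eval_mul, eval_C]
  · simp only [polyPieceDeriv_of_le (not_lt.mp hx), Pi.smul_apply, smul_eq_mul, mul_zero, Finset.sum_const_zero]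

/-- **TAYLOR AT THE KINK:** a polynomial with `p(θ) = 0` is `Σ_{k < deg p} c_{k+1}·(X − θ)^{k+1}` with
`c_k = (taylor θ p).coeff k` — the constant Taylor coefficient is `p(θ) = 0` (Mathlib `Polynomial.sum_taylor_eq`,
`taylor_coeff_zero`). [folklore] -/
private theorem eq_sum_binomPoly_of_eval_eq_zero {p : ℂ[X]} (hp : p.eval (θ : ℂ) = 0) :
    p = ∑ k ∈ Finset.range p.natDegree, C ((taylor (θ : ℂ) p).coeff (k + 1)) * binomPoly θ (k + 1) := by
  have h := sum_taylor_eq p (θ : ℂ)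
  rw [Polynomial.sum_over_range' _ (fun i => by simp) (p.natDegree + 1) (by rw [natDegree_taylor]; omega),
    Finset.sum_range_succ', taylor_coeff_zero, hp, map_zero, zero_mul, add_zero] at h
  exact h.symm

/-- **Every polynomial short piece is a finite ℂ-combination of binomial pieces of the SAME length**, its marked
derivative being the same combination of their marked derivatives (Taylor at the kink; orders `k + 1 ≥ 1`).
[cite: Zhang2022LandauSiegel, §7 (7.2) p.13, §8 Lemma 8.2 p.16] -/
theorem PolyShortPiece.exists_binom_decomp {u u' : ℝ → ℂ} (h : PolyShortPiece θ u u') :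
    ∃ (n : ℕ) (a : ℕ → ℂ), u = ∑ k ∈ Finset.range n, a k • binomPiece θ (k + 1) ∧
      u' = ∑ k ∈ Finset.range n, a k • binomPieceDeriv θ (k + 1) := by
  obtain ⟨p, hp, rfl, rfl⟩ := h.exists_poly
  have hT := eq_sum_binomPoly_of_eval_eq_zero hp
  refine ⟨p.natDegree, fun k => (taylor (θ : ℂ) p).coeff (k + 1), ?_, ?_⟩
  · exact (congrArg (polyPiece θ) hT).trans (polyPiece_finset_sum _ _ _)
  · exact (congrArg (polyPieceDeriv θ) hT).trans (polyPieceDeriv_finset_sum _ _ _)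

end Binom

/-! ### Part 4 — the class of binomial short pairs and the reductions of the three poly-class darkness inputs -/

section Reduction

/-- **The class of BINOMIAL SHORT PAIRS:** pairs `(binomPiece θ_f k, binomPiece θ_g l)` of binomial pieces of positive
lengths `θ_f, θ_g ≤ 1` with `θ_f + θ_g < 1` and orders `k, l ≥ 1` — one explicit two-parameter family per side, a sub-class
of `PolyShortPairs` (`binomShortPairs_polyShortPairs`) to which the three poly-class darkness inputs reduce
(`crossTablePsiOn_poly_zero_of_binom`, `dualCrossTablePsiOn_poly_zero_of_binom`). [cite: Zhang2022LandauSiegel, §7 (7.2) p.13, §8 Lemma 8.2 p.16, Lemma 8.4 p.17] -/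
def BinomShortPairs : PairClass := fun f f' g g' =>
  ∃ (θf θg : ℝ) (k l : ℕ), 0 < θf ∧ 0 < θg ∧ θf ≤ 1 ∧ θg ≤ 1 ∧ θf + θg < 1 ∧ 1 ≤ k ∧ 1 ≤ l ∧
    f = binomPiece θf k ∧ f' = binomPieceDeriv θf k ∧ g = binomPiece θg l ∧ g' = binomPieceDeriv θg l

variable {c' : ℝ} {d : ℕ} {f f' g g' : ℝ → ℂ}

/-- Binomial short pairs are polynomial short pairs. [cite: Zhang2022LandauSiegel, §7 (7.2) p.13] -/
theorem binomShortPairs_polyShortPairs (h : BinomShortPairs f f' g g') : PolyShortPairs f f' g g' := by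
  obtain ⟨θf, θg, k, l, -, -, hf1, hg1, hsum, hk, hl, rfl, rfl, rfl, rfl⟩ := h
  exact ⟨θf, θg, hsum, polyShortPiece_binom hf1 hk, polyShortPiece_binom hg1 hl⟩

/-- Binomial short pairs are short pairs. [cite: Zhang2022LandauSiegel, §7 (7.2) p.13] -/
theorem binomShortPairs_shortPairs (h : BinomShortPairs f f' g g') : ShortPairs f f' g g' :=
  polyShortPairs_shortPairs (binomShortPairs_polyShortPairs h)

/-- A polynomial piece of non-positive length vanishes on `[0, ∞)`. [cite: Zhang2022LandauSiegel, §7 (7.2) p.13] -/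
theorem polyPiece_eq_zero_of_nonpos {θ : ℝ} {p : ℂ[X]} (hθ : θ ≤ 0) {z : ℝ} (hz : 0 ≤ z) : polyPiece θ p z = 0 :=
  polyPiece_of_le (hθ.trans hz)

/-- The trivially-eventual estimate: a cell that is `0` at every modulus is `o(𝔞𝔓)` (`𝔞, 𝔓 ≥ 0`).
[cite: Zhang2022LandauSiegel, §2 (2.9), (2.31)] -/
private theorem forAllLarge_norm_le_of_eq_zero {T : (D : ℕ) → DirichletCharacter ℂ D → ℂ}
    (hT : ∀ (D : ℕ) (χ : DirichletCharacter ℂ D), T D χ = 0) {ε : ℝ} (hε : 0 < ε) :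
    ForAllLarge fun D _ χ => AssumptionA D χ → ‖T D χ‖ ≤ ε * frakA χ * frakP D :=
  ⟨0, fun D _ χ _ _ _ _ => by
    rw [hT, norm_zero]
    exact mul_nonneg (mul_nonneg hε.le (frakA_nonneg χ)) (frakP_nonneg D)⟩

/-- **REDUCTION (cross cell, any degree `d`): darkness on the binomial short pairs ⇒ darkness on ALL polynomial short
pairs.** Given a polynomial short pair, expand both pieces in binomial pieces of the same lengths (Part 3) and transfer
darkness along the expansion (Part 2); a piece of non-positive length has the zero profile polynomial. For `d = 1` / `d = 2`
the conclusion is the x₁|short / x₂|short input of the ports on `PolyShortPairs`. [cite: Zhang2022LandauSiegel, §7 (7.2) p.13, §8 (8.5) Lemma 8.2 p.16] -/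
theorem crossTablePsiOn_poly_zero_of_binom (h : CrossTablePsiOn c' BinomShortPairs d (fun _ _ _ _ => 0)) :
    CrossTablePsiOn c' PolyShortPairs d (fun _ _ _ _ => 0) := by
  rw [crossTablePsiOn_zero_iff] at h ⊢
  intro f f' g g' _ _ hC ε hε
  obtain ⟨θf, θg, hsum, hF, hG⟩ := hC
  by_cases hθf : θf ≤ 0
  · -- the `f`-piece has the zero profile polynomial
    obtain ⟨p, -, rfl, -⟩ := hF.exists_poly
    refine forAllLarge_norm_le_of_eq_zero (fun D χ => ?_) hε
    have hz : (fun (y : Chr D) (t : ℂ) => profPoly χ y (polyPiece θf p) (⌊bigP D⌋₊ + 1) t) = fun _ _ => 0 := by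
      funext y t
      exact profPoly_eq_zero_of_vanish χ y _ t fun z hz => polyPiece_eq_zero_of_nonpos hθf hz
    rw [crossCell, hz, zDegMeanPsi_zero_right]
  by_cases hθg : θg ≤ 0
  · -- the `g`-piece has the zero profile polynomial
    obtain ⟨q, -, rfl, -⟩ := hG.exists_poly
    refine forAllLarge_norm_le_of_eq_zero (fun D χ => ?_) hε
    have hz : (fun (y : Chr D) (t : ℂ) => conj (profPoly χ y (polyPiece θg q) (⌊bigP D⌋₊ + 1) t)) = fun _ _ => 0 := by
      funext y t
      rw [profPoly_eq_zero_of_vanish χ y _ t fun z hz => polyPiece_eq_zero_of_nonpos hθg hz, map_zero]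
    rw [crossCell, hz, zDegMeanPsi_zero_left]
  push Not at hθf hθg
  obtain ⟨n, a, rfl, rfl⟩ := hF.exists_binom_decomp
  obtain ⟨m, b, rfl, rfl⟩ := hG.exists_binom_decomp
  refine crossCell_dark_of_sum (Finset.range n) (Finset.range m) a b (fun k => binomPiece θf (k + 1))
    (fun l => binomPiece θg (l + 1)) (fun k _ l _ ε' hε' => ?_) ε hε
  exact h _ _ _ _ (polyShortPiece_binom hF.le_one (Nat.le_add_left 1 k)).inClassPiece
    (polyShortPiece_binom hG.le_one (Nat.le_add_left 1 l)).inClassPiece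
    ⟨θf, θg, k + 1, l + 1, hθf, hθg, hF.le_one, hG.le_one, hsum, Nat.le_add_left 1 k, Nat.le_add_left 1 l,
      rfl, rfl, rfl, rfl⟩ ε' hε'

/-- **REDUCTION (dual cell, any degree `d`): darkness on the binomial short pairs ⇒ darkness on ALL polynomial short
pairs** — for `d = 1` the y₁|short input of the ports on `PolyShortPairs`. [cite: Zhang2022LandauSiegel, §2 (2.17), §7 (7.2) p.13, §8 (8.5) Lemma 8.4 p.17] -/
theorem dualCrossTablePsiOn_poly_zero_of_binom (h : DualCrossTablePsiOn c' BinomShortPairs d (fun _ _ _ _ => 0)) :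
    DualCrossTablePsiOn c' PolyShortPairs d (fun _ _ _ _ => 0) := by
  rw [dualCrossTablePsiOn_zero_iff] at h ⊢
  intro g₁ g₁' g₂ g₂' _ _ hC ε hε
  obtain ⟨θ₁, θ₂, hsum, h₁, h₂⟩ := hC
  by_cases hθ₁ : θ₁ ≤ 0
  · obtain ⟨p, -, rfl, -⟩ := h₁.exists_poly
    refine forAllLarge_norm_le_of_eq_zero (fun D χ => ?_) hε
    have hz : (fun (y : Chr D) (t : ℂ) => conj (profPoly χ y (polyPiece θ₁ p) (⌊bigP D⌋₊ + 1) t)) = fun _ _ => 0 := by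
      funext y t
      rw [profPoly_eq_zero_of_vanish χ y _ t fun z hz => polyPiece_eq_zero_of_nonpos hθ₁ hz, map_zero]
    rw [dualCell, hz, zDegMeanPsi_zero_right]
  by_cases hθ₂ : θ₂ ≤ 0
  · obtain ⟨q, -, rfl, -⟩ := h₂.exists_poly
    refine forAllLarge_norm_le_of_eq_zero (fun D χ => ?_) hε
    have hz : (fun (y : Chr D) (t : ℂ) => conj (profPoly χ y (polyPiece θ₂ q) (⌊bigP D⌋₊ + 1) t)) = fun _ _ => 0 := by
      funext y t
      rw [profPoly_eq_zero_of_vanish χ y _ t fun z hz => polyPiece_eq_zero_of_nonpos hθ₂ hz, map_zero]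
    rw [dualCell, hz, zDegMeanPsi_zero_left]
  push Not at hθ₁ hθ₂
  obtain ⟨n, a, rfl, rfl⟩ := h₁.exists_binom_decomp
  obtain ⟨m, b, rfl, rfl⟩ := h₂.exists_binom_decomp
  refine dualCell_dark_of_sum (Finset.range n) (Finset.range m) a b (fun k => binomPiece θ₁ (k + 1))
    (fun l => binomPiece θ₂ (l + 1)) (fun k _ l _ ε' hε' => ?_) ε hε
  exact h _ _ _ _ (polyShortPiece_binom h₁.le_one (Nat.le_add_left 1 k)).inClassPiece
    (polyShortPiece_binom h₂.le_one (Nat.le_add_left 1 l)).inClassPiece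
    ⟨θ₁, θ₂, k + 1, l + 1, hθ₁, hθ₂, h₁.le_one, h₂.le_one, hsum, Nat.le_add_left 1 k, Nat.le_add_left 1 l,
      rfl, rfl, rfl, rfl⟩ ε' hε'

/-- **The reduction under any rider and eventually in `c′` (cross cell):** if, for all large `c′`, a hypothesis `H c′`
(e.g. the repaired K0 `InClassMeanPiece c′`) gives darkness on the binomial short pairs, then it gives darkness on the
polynomial short pairs — the conclusion is the ports' darkness binder. [cite: Zhang2022LandauSiegel, §7 (7.2) p.13, §8 (8.5) Lemma 8.2 p.16] -/
theorem polyDark_cross_eventually_of_binom {H : ℝ → Prop}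
    (h : ∃ c₀ : ℝ, ∀ c' : ℝ, c₀ ≤ c' → H c' → CrossTablePsiOn c' BinomShortPairs d (fun _ _ _ _ => 0)) :
    ∃ c₀ : ℝ, ∀ c' : ℝ, c₀ ≤ c' → H c' → CrossTablePsiOn c' PolyShortPairs d (fun _ _ _ _ => 0) := by
  obtain ⟨c₀, hc⟩ := h
  exact ⟨c₀, fun c' hc' hH => crossTablePsiOn_poly_zero_of_binom (hc c' hc' hH)⟩

/-- **The reduction under any rider and eventually in `c′` (dual cell).** [cite: Zhang2022LandauSiegel, §2 (2.17), §7 (7.2) p.13, §8 (8.5) Lemma 8.4 p.17] -/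
theorem polyDark_dual_eventually_of_binom {H : ℝ → Prop}
    (h : ∃ c₀ : ℝ, ∀ c' : ℝ, c₀ ≤ c' → H c' → DualCrossTablePsiOn c' BinomShortPairs d (fun _ _ _ _ => 0)) :
    ∃ c₀ : ℝ, ∀ c' : ℝ, c₀ ≤ c' → H c' → DualCrossTablePsiOn c' PolyShortPairs d (fun _ _ _ _ => 0) := by
  obtain ⟨c₀, hc⟩ := h
  exact ⟨c₀, fun c' hc' hH => dualCrossTablePsiOn_poly_zero_of_binom (hc c' hc' hH)⟩

/-! #### The composed ports: binomial darkness + the repaired K0 ⇒ darkness on ALL short pairs -/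

/-- **PORT over the binomial family (cross cell, any degree), repaired K0 at `c′`:** darkness on `BinomShortPairs` +
`InClassMeanPiece c′` + Lemma 2.3 at `c′` ⇒ `CrossTablePsiOn c′ ShortPairs d 0` (`crossTablePsiOn_short_zero_of_poly_piece`,
p538281, over this file's reduction). [cite: Zhang2022LandauSiegel, §2 Lemma 2.3, §7 Prop 7.1 (7.2), §8 (8.5) Lemma 8.1 Lemma 8.2 p.16] -/
theorem crossTablePsiOn_short_zero_of_binom_piece (hdark : CrossTablePsiOn c' BinomShortPairs d (fun _ _ _ _ => 0))
    (hK0 : InClassMeanPiece c') (h23 : Lemma23 c') : CrossTablePsiOn c' ShortPairs d (fun _ _ _ _ => 0) :=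
  crossTablePsiOn_short_zero_of_poly_piece (𝒞₀ := PolyShortPairs) (fun _ _ _ _ hp => hp)
    (crossTablePsiOn_poly_zero_of_binom hdark) hK0 h23

/-- **PORT over the binomial family (dual cell, any degree), repaired K0 at `c′`.** [cite: Zhang2022LandauSiegel, §2 (2.17) Lemma 2.3, §8 (8.5) Lemma 8.1 p.16, Lemma 8.4 p.17] -/
theorem dualCrossTablePsiOn_short_zero_of_binom_piece (hdark : DualCrossTablePsiOn c' BinomShortPairs d (fun _ _ _ _ => 0))
    (hK0 : InClassMeanPiece c') (h23 : Lemma23 c') : DualCrossTablePsiOn c' ShortPairs d (fun _ _ _ _ => 0) :=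
  dualCrossTablePsiOn_short_zero_of_poly_piece (𝒞₀ := PolyShortPairs) (fun _ _ _ _ hp => hp)
    (dualCrossTablePsiOn_poly_zero_of_binom hdark) hK0 h23

/-- **PORT over the binomial family, eventually in `c′` (cross cell, any degree), repaired K0** = `InClassSideTablesPiece`
(stmt-Parity-20459) + darkness on `BinomShortPairs` for all large `c′` (allowed to use the repaired K0 at the same `c′`) ⇒
`∃ c₀, ∀ c′ ≥ c₀, CrossTablePsiOn c′ ShortPairs d 0` — `d = 1`: the `hX` input of the kill path
(`Theorems/ZDegreeToeplitzBandDarkSchur`) and stmt-Parity-20444 with `X₁ := 0`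
(`Theorems/ZDegreeToeplitzBandShortPairsCrossDegOneOfPolyPiece`). [cite: Zhang2022LandauSiegel, §2 Lemma 2.3, §8 (8.5) Lemma 8.1 Lemma 8.2 p.16] -/
theorem crossTablePsiOn_short_zero_eventually_of_binom_piece
    (hK0 : ∃ c₀ : ℝ, ∀ c' : ℝ, c₀ ≤ c' → InClassMeanPiece c')
    (hdark : ∃ c₀ : ℝ, ∀ c' : ℝ, c₀ ≤ c' → InClassMeanPiece c' →
      CrossTablePsiOn c' BinomShortPairs d (fun _ _ _ _ => 0)) :
    ∃ c₀ : ℝ, ∀ c' : ℝ, c₀ ≤ c' → CrossTablePsiOn c' ShortPairs d (fun _ _ _ _ => 0) :=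
  crossTablePsiOn_short_zero_eventually_of_poly_piece (𝒞₀ := PolyShortPairs) (fun _ _ _ _ hp => hp) hK0
    (polyDark_cross_eventually_of_binom hdark)

/-- **PORT over the binomial family, eventually in `c′` (dual cell, any degree), repaired K0** — `d = 1`: the `hY` input of
the kill path and stmt-Parity-20445 with `Y₁ := 0` (`Theorems/ZDegreeToeplitzBandShortPairsDualDegOneOfPolyPiece`).
[cite: Zhang2022LandauSiegel, §2 (2.17) Lemma 2.3, §8 (8.5) Lemma 8.1 p.16, Lemma 8.4 p.17] -/
theorem dualCrossTablePsiOn_short_zero_eventually_of_binom_piece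
    (hK0 : ∃ c₀ : ℝ, ∀ c' : ℝ, c₀ ≤ c' → InClassMeanPiece c')
    (hdark : ∃ c₀ : ℝ, ∀ c' : ℝ, c₀ ≤ c' → InClassMeanPiece c' →
      DualCrossTablePsiOn c' BinomShortPairs d (fun _ _ _ _ => 0)) :
    ∃ c₀ : ℝ, ∀ c' : ℝ, c₀ ≤ c' → DualCrossTablePsiOn c' ShortPairs d (fun _ _ _ _ => 0) :=
  dualCrossTablePsiOn_short_zero_eventually_of_poly_piece (𝒞₀ := PolyShortPairs) (fun _ _ _ _ hp => hp) hK0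
    (polyDark_dual_eventually_of_binom hdark)

/-- **PORT over the binomial family, eventually in `c′` (the degree-2 cell):** `InClassSideTablesPiece` + x₂-darkness on
`BinomShortPairs` for all large `c′` ⇒ `∃ c₀, ∀ c′ ≥ c₀, TauTwoDarkShort c′` — the statement of stmt-Parity-20429
`ShortPairsTauTwoDark` modulo its two open inputs, the darkness input now on one explicit family
(`Theorems/ZDegreeToeplitzBandShortPairsTauTwoDarkOfPolyPiece`). [cite: Zhang2022LandauSiegel, §2 Lemma 2.3, §4 Lemma 4.8 p.9, §8 (8.5) Lemma 8.1 Lemma 8.2 p.16] -/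
theorem tauTwoDarkShort_eventually_of_binom_piece
    (hK0 : ∃ c₀ : ℝ, ∀ c' : ℝ, c₀ ≤ c' → InClassMeanPiece c')
    (hdark : ∃ c₀ : ℝ, ∀ c' : ℝ, c₀ ≤ c' → InClassMeanPiece c' →
      CrossTablePsiOn c' BinomShortPairs 2 (fun _ _ _ _ => 0)) :
    ∃ c₀ : ℝ, ∀ c' : ℝ, c₀ ≤ c' → TauTwoDarkShort c' :=
  crossTablePsiOn_short_zero_eventually_of_binom_piece hK0 hdark

end Reduction

end Literature.NumberTheory.LFunctions.Zhang2022.KnifeEdge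

end
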